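import Mathlib
import HarnessLib
import Literature.MathematicalPhysics.QuantumFieldTheory.ConstructiveQFTWave0
import Literature.MathematicalPhysics.QuantumLattice.AbelianFieldTensor
import Literature.MathematicalPhysics.QuantumLattice.AbelianMagneticFlux
import Summits.Ventures.LatticeQCDFlow.Scaling.FluxSectorCollar
import Summits.Ventures.LatticeQCDFlow.Scaling.FluxPatch
import Summits.Ventures.LatticeQCDFlow.Scaling.FluxTunnelling
import Summits.Ventures.LatticeQCDFlow.Scaling.SliceTwistWitness
import Summits.Ventures.LatticeQCDFlow.Scaling.BoxPeel
import Summits.Ventures.LatticeQCDFlow.Scaling.RowFields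
import Summits.Ventures.LatticeQCDFlow.Scaling.BoxSpreadWitness

/-!
# LatticeQCDFlow / Scaling — the touching positions of a block and the flux law on a block at `2 sin(π/(2(l-1)(l+3)))` (v3.6, (C7b″) sharp form, supplement)

HONEST FRAMING: exact (Metropolis-corrected) sampling algorithms for lattice gauge theory; figures
of merit are autocorrelation/cost numbers at stated couplings and volumes; no continuum-physics
claim.

THEORY-2.md §4 (C7(b″)), §5.17.  `U(1) = Circle`, `d = 2`, torus `(ℤ/L)²`, `2 ≤ l`, `l + 1 ≤ L`;
update set = the block `boxLinks 1 l` of `BoxPeel.lean`.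

* **Geometry.**  If a link of the plaquette at `x` lies in the block then
  `((x 0).val, (x 1).val)` lies in the touching region `R_l = {0,…,l}² ∖ corners` of
  `BoxSpreadWitness.lean` (`inR_of_touch`, by the box coordinates `coord 1 x j`), so the touching
  plane positions lie in the image `boxPositions l L` of the `(l+1)² - 4 = (l-1)(l+3)` non-corner
  pairs (`mem_boxPositions_of_touch`, `card_boxPositionsNat`, `card_boxPositions_le`).
* **The law.**  The max-plaquette flux law of `RowFields.lean` with `P = boxPositions l L`,
  `#P ≤ (l-1)(l+3)`, and the monotonicity of `2 sin(π/(2·#P))` in `#P`: every `μ`-invariant Markov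
  pair moving only the block satisfies
  `(μ ⊗ κ){Q ≠ Q'} ≤ 2·μ{∃ p, dist(U_p,1) ≥ 2 sin(π/(2(l-1)(l+3)))}` (`fluxLaw_boxLinks_sharp`).
  `BoxSpreadPair.lean` shows this threshold cannot be raised.
-/

noncomputable section

namespace Summit.Ventures.LatticeQCDFlow.Theory2.Lattice.Flux

open MeasureTheory ProbabilityTheory Metric Set Filter Topology Real
open scoped ENNReal
open Literature.MathematicalPhysics.QuantumFieldTheory Literature.MathematicalPhysics.QuantumLattice

/-! ## The touching positions and the law -/

section Touch

variable {L : ℕ} [NeZero L] {l : ℕ}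

/-- The non-corner positions of `{0,…,l}²` as natural-number pairs. [folklore] -/
def boxPositionsNat (l : ℕ) : Finset (ℕ × ℕ) :=
  (Finset.range (l + 1) ×ˢ Finset.range (l + 1)).filter
    (fun q => ¬((q.1 = 0 ∨ q.1 = l) ∧ (q.2 = 0 ∨ q.2 = l)))

/-- `# boxPositionsNat = (l+1)² - 4`. [folklore] -/
theorem card_boxPositionsNat (hl : 2 ≤ l) : (boxPositionsNat l).card = (l + 1) * (l + 1) - 4 := by
  have hc : ((Finset.range (l + 1) ×ˢ Finset.range (l + 1)).filter
      (fun q : ℕ × ℕ => (q.1 = 0 ∨ q.1 = l) ∧ (q.2 = 0 ∨ q.2 = l))) =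
      ({0, l} : Finset ℕ) ×ˢ ({0, l} : Finset ℕ) := by
    ext ⟨i, j⟩
    simp only [Finset.mem_filter, Finset.mem_product, Finset.mem_range, Finset.mem_insert,
      Finset.mem_singleton]
    omega
  have h := Finset.card_filter_add_card_filter_not
    (s := Finset.range (l + 1) ×ˢ Finset.range (l + 1))
    (fun q : ℕ × ℕ => (q.1 = 0 ∨ q.1 = l) ∧ (q.2 = 0 ∨ q.2 = l))
  rw [hc, Finset.card_product, Finset.card_product, Finset.card_range,
    Finset.card_pair (show (0 : ℕ) ≠ l by omega)] at h
  unfold boxPositionsNat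
  omega

/-- **The touching positions of the block**: the image of the non-corner positions in
`(ℤ/L)²`. [folklore] -/
def boxPositions (l L : ℕ) : Finset (ZMod L × ZMod L) :=
  (boxPositionsNat l).image (fun q => ((q.1 : ZMod L), (q.2 : ZMod L)))

omit [NeZero L] in
/-- `# boxPositions ≤ R_l = (l-1)(l+3)` (as a real number). [folklore] -/
theorem card_boxPositions_le (hl : 2 ≤ l) :
    ((boxPositions l L).card : ℝ) ≤ ((l : ℝ) - 1) * ((l : ℝ) + 3) := by
  have h := (Finset.card_image_le (s := boxPositionsNat l)
    (f := fun q : ℕ × ℕ => ((q.1 : ZMod L), (q.2 : ZMod L))))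
  rw [card_boxPositionsNat hl] at h
  have h4 : 4 ≤ (l + 1) * (l + 1) := by nlinarith
  have : (((l + 1) * (l + 1) - 4 : ℕ) : ℝ) = ((l : ℝ) - 1) * ((l : ℝ) + 3) := by
    rw [Nat.cast_sub h4]; push_cast; ring
  rw [← this]
  exact_mod_cast h

/-- A position with representatives in `R_l` is a touching position. [folklore] -/
theorem mem_boxPositions_of_inR {p : ZMod L × ZMod L} (h : inR l p.1.val p.2.val) :
    p ∈ boxPositions l L := by
  obtain ⟨h1, h2, h3⟩ := h
  refine Finset.mem_image.mpr ⟨(p.1.val, p.2.val), ?_, ?_⟩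
  · unfold boxPositionsNat
    simp only [Finset.mem_filter, Finset.mem_product, Finset.mem_range]
    exact ⟨⟨by omega, by omega⟩, h3⟩
  · simp only [ZMod.natCast_zmod_val]

/-- Box coordinates relative to the corner `1`: `L - 1` on coordinate `0`, `(x j).val - 1`
otherwise. [folklore] -/
theorem coord_one_cases [Fact (1 < L)] (x : Site 2 L) (j : Fin 2) :
    coord (1 : Site 2 L) x j = if (x j).val = 0 then L - 1 else (x j).val - 1 := by
  split_ifs with h
  · have hx : x j = 0 := (ZMod.val_eq_zero _).mp h
    unfold coord
    rw [Pi.sub_apply, Pi.one_apply, hx, zero_sub, ZMod.neg_val, if_neg one_ne_zero, ZMod.val_one]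
  · exact coord_one_eq x j (by omega)

/-- **Only positions of `R_l` touch the block**: if a link of the plaquette at `x` lies in
`boxLinks 1 l` then `((x 0).val, (x 1).val) ∈ R_l`. [folklore] -/
theorem inR_of_touch (hl : 2 ≤ l) (hlL : l + 1 ≤ L) (x : Site 2 L) {e : Edge 2 L}
    (he : e ∈ plaqLinks x 0 1) (hb : e ∈ boxLinks (1 : Site 2 L) l) :
    inR l (x 0).val (x 1).val := by
  haveI : Fact (1 < L) := ⟨by omega⟩
  have ha := ZMod.val_lt (x 0)
  have hb' := ZMod.val_lt (x 1)
  have s00 : (x.shift 0) 0 = x 0 + 1 ∧ (x.shift 0) 1 = x 1 := by constructor <;> simp [Site.shift]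
  have s11 : (x.shift 1) 0 = x 0 ∧ (x.shift 1) 1 = x 1 + 1 := by constructor <;> simp [Site.shift]
  have c0 := coord_one_cases x 0
  have c1 := coord_one_cases x 1
  have d0 := coord_one_cases (x.shift 0) 0
  have d1 := coord_one_cases (x.shift 0) 1
  have e0 := coord_one_cases (x.shift 1) 0
  have e1 := coord_one_cases (x.shift 1) 1
  rw [s00.1, val_add_one_eq] at d0
  rw [s00.2] at d1
  rw [s11.1] at e0
  rw [s11.2, val_add_one_eq] at e1
  unfold inR
  rw [boxLinks, Set.mem_setOf_eq] at hb
  obtain ⟨hB, hi⟩ := hb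
  simp only [plaqLinks, Finset.mem_insert, Finset.mem_singleton] at he
  rcases he with rfl | rfl | rfl | rfl
  · have h0 := hB 0; have h1 := hB 1
    simp only at h0 h1 hi
    rw [c0] at hi; rw [c1] at h1
    split_ifs at hi h1 <;> omega
  · have h0 := hB 0; have h1 := hB 1
    simp only at h0 h1 hi
    rw [d0] at h0; rw [d1] at hi
    split_ifs at h0 hi <;> omega
  · have h0 := hB 0; have h1 := hB 1
    simp only at h0 h1 hi
    rw [e0] at hi; rw [e1] at h1
    split_ifs at hi h1 <;> omega
  · have h0 := hB 0; have h1 := hB 1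
    simp only at h0 h1 hi
    rw [c0] at h0; rw [c1] at hi
    split_ifs at h0 hi <;> omega

open Classical in
/-- The block as a finite link set. [folklore] -/
def boxFinset (l L : ℕ) [NeZero L] : Finset (Edge 2 L) :=
  Finset.univ.filter (fun e => e ∈ boxLinks (1 : Site 2 L) l)

/-- `boxFinset` is `boxLinks 1 l`. [folklore] -/
theorem mem_boxFinset {e : Edge 2 L} : e ∈ boxFinset l L ↔ e ∈ boxLinks (1 : Site 2 L) l := by
  simp [boxFinset]

/-- Touching positions lie in `boxPositions`. [folklore] -/
theorem mem_boxPositions_of_touch (hl : 2 ≤ l) (hlL : l + 1 ≤ L) (p : ZMod L × ZMod L)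
    (h : ∃ e ∈ plaqLinks (planeSite (0 : Site 2 L) 0 1 p) 0 1, e ∈ boxFinset l L) :
    p ∈ boxPositions l L := by
  obtain ⟨e, he, heB⟩ := h
  have hx : (planeSite (0 : Site 2 L) 0 1 p) 0 = p.1 ∧ (planeSite (0 : Site 2 L) 0 1 p) 1 = p.2 := by
    constructor <;> simp [planeSite]
  have hR := inR_of_touch hl hlL (planeSite (0 : Site 2 L) 0 1 p) he (mem_boxFinset.mp heB)
  rw [hx.1, hx.2] at hR
  exact mem_boxPositions_of_inR hR

/-- Monotonicity of the max-plaquette threshold in the number of positions. [folklore] -/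
theorem two_sin_le_two_sin {P R : ℝ} (hP : 1 ≤ P) (hPR : P ≤ R) :
    2 * Real.sin (π / (2 * R)) ≤ 2 * Real.sin (π / (2 * P)) := by
  have h1 : π / (2 * R) ≤ π / (2 * P) :=
    div_le_div_of_nonneg_left Real.pi_pos.le (by linarith) (by linarith)
  have h2 : π / (2 * P) ≤ π / 2 := by
    rw [div_le_div_iff₀ (by linarith) two_pos]; nlinarith [Real.pi_pos]
  have h3 : -(π / 2) ≤ π / (2 * R) := by
    have : 0 ≤ π / (2 * R) := div_nonneg Real.pi_pos.le (by linarith)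
    linarith [Real.pi_pos]
  linarith [Real.sin_le_sin_of_le_of_le_pi_div_two h3 h2 h1]

/-- **THE FLUX LAW ON AN `l`-BLOCK AT THE SHARP THRESHOLD** (`2 ≤ l`, `l + 1 ≤ L`, every invariant
measure): a `μ`-invariant Markov pair moving only `boxLinks 1 l` changes the flux charge with
stationary probability `≤ 2·μ{∃ p, dist(U_p, 1) ≥ 2 sin(π/(2(l-1)(l+3)))}`. [folklore] -/
theorem fluxLaw_boxLinks_sharp (hl : 2 ≤ l) (hlL : l + 1 ≤ L) (μ : Measure (GaugeConfig 2 L Circle))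
    [SFinite μ] (κ : Kernel (GaugeConfig 2 L Circle) (GaugeConfig 2 L Circle)) [IsMarkovKernel κ]
    (hinv : κ.Invariant μ)
    (hloc : ∀ᵐ q ∂(μ ⊗ₘ κ), ∀ e ∉ boxLinks (1 : Site 2 L) l, q.1 e = q.2 e) :
    (μ ⊗ₘ κ) {q | topCharge (0 : Site 2 L) 0 1 q.1 ≠ topCharge (0 : Site 2 L) 0 1 q.2} ≤
      2 * μ {U | ∃ p : Plaquette 2 L, 2 * Real.sin (π / (2 * (((l : ℝ) - 1) * ((l : ℝ) + 3)))) ≤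
        dist (plaquetteHolonomy U p.1 p.2.1.1 p.2.1.2) 1} := by
  have h11 : ((1 : ℕ), (1 : ℕ)) ∈ boxPositionsNat l := by
    unfold boxPositionsNat
    simp only [Finset.mem_filter, Finset.mem_product, Finset.mem_range]
    omega
  have hne : (boxPositions l L).Nonempty := ⟨_, Finset.mem_image_of_mem _ h11⟩
  have hcard : (1 : ℝ) ≤ (boxPositions l L).card := by exact_mod_cast Finset.card_pos.mpr hne
  have h := compProd_topCharge_ne_le_of_links_maxPlaquette (0 : Site 2 L) 0 1 (boxFinset l L) hne
    (mem_boxPositions_of_touch hl hlL) μ κ hinv (by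
      filter_upwards [hloc] with q hq e he
      exact hq e (by rwa [mem_boxFinset] at he))
  refine h.trans (mul_le_mul_right (measure_mono ?_) 2)
  rintro U ⟨p, -, hp⟩
  exact ⟨⟨planeSite (0 : Site 2 L) 0 1 p, ⟨(0, 1), by decide⟩⟩,
    (two_sin_le_two_sin hcard (card_boxPositions_le hl)).trans hp⟩

end Touch

end Summit.Ventures.LatticeQCDFlow.Theory2.Lattice.Flux
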